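import Mathlib
import HarnessLib.Audit
import Summits.PneNP.PneNP.Theorems.PstarSharpGateBudgetAssembly
import Summits.PneNP.PneNP.Theorems.PstarLocalCriterion

/-!
# The census node over LOCAL readers (ROUND-24, O1; memo g26 §63)

FRONTIER range-avoidance ladder, rung F-N3, ROUND 24 (cell `pnp-ideate`, prover-2 memo `g26/O1-LOCALITY-g26.md` §63; typed targets
`PstarCoreBoundTargets.TerminalFive` / `TerminalPeelable` (p646951); restricted-model proof complexity — nothing here bears on `P` versus `NP`).

`PstarLocalCriterion.noSmallPathSumSubcoreExact_of_noLocalCore` lets the census discharge branch (A) of the sharp gate-budget node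
(`PstarSharpGateBudgetAssembly.SharpMenuCriterionBoundGateBudget`) by testing LOCAL second readers only (monomials and linear reads over
`T(K₀) ∪ ANDvars(F₁)`), on sub-families of `K₀`.  This file states the corresponding node and plugs it into the chain:

* node **`LocalMenuCriterionBoundGateBudget`** — as the sharp gate-budget node, with `NoLocalCore c G` (local pair satisfiable, no `TerminalNC` sub-core
  of `K₀`) in place of `NoSmallPathSumSubcoreExact c G`, and the exact coincidence clause `NoCoincidenceExact c G` unchanged;
* `sharpGateBudget_of_local : LocalMenuCriterionBoundGateBudget → SharpMenuCriterionBoundGateBudget`;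
* **`terminalFive_of_localMenuBoundGateBudget : TerminalFiveA → LocalMenuCriterionBoundGateBudget → TerminalFive`**, `terminalPeelable_of_…`;
* **`menu_far_of_disjoint_near`** — CLUSTERING: if a second exact certificate `(K₀'; d₁', d₂')` of the SAME channel menu `G` has its near variables
  inside the far variables of `(K₀, d₁)`, then every monomial of `G` has a far variable for `(K₀, d₁)` — so the local reader of the first certificate is
  MENU-FREE (`nearMonomials (G ∪ F₂) far = nearMonomials F₂ far`): two far-apart certificates of one channel reduce to menu-free local cores.
-/

set_option linter.dupNamespace false -- `Summit.PneNP.PneNP.…`: summit = sub-problem name (D-0017 single-conjunct layout)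

open Finset Literature.Computability.Complexity
open Summit.PneNP.PneNP.Theorems.PstarTyped (Typed)
open Summit.PneNP.PneNP.Theorems.PstarSALevel (varSet bdry BoundaryExpanding SimpleOverlap)
open Summit.PneNP.PneNP.Theorems.PstarXCore (xverts)
open Summit.PneNP.PneNP.Theorems.PstarChordRepair (IsChord)
open Summit.PneNP.PneNP.Theorems.PstarCoreBoundTargets (Terminal TerminalFive TerminalFiveA TerminalPeelable terminalPeelable_of_terminalFive)
open Summit.PneNP.PneNP.Theorems.PstarSharingBound (sharedSlots)
open Summit.PneNP.PneNP.Theorems.PstarChordBridgeTools (xpdeg)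
open Summit.PneNP.PneNP.Theorems.PstarChordReadOutside (OutsideGated)
open Summit.PneNP.PneNP.Theorems.PstarNoFreeVertex (Covered)
open Summit.PneNP.PneNP.Theorems.PstarHangingForest (Anchored)
open Summit.PneNP.PneNP.Theorems.PstarCleanCutAssembly (SkConnected NoTwoCrossings)
open Summit.PneNP.PneNP.Theorems.PstarMenuCriterion (channelMenus)
open Summit.PneNP.PneNP.Theorems.PstarCoincidenceExact (NoCoincidenceExact)
open Summit.PneNP.PneNP.Theorems.PstarSkeletonSpan (XConnected)
open Summit.PneNP.PneNP.Theorems.PstarCentreGateBudgetAssembly (GateBudget)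
open Summit.PneNP.PneNP.Theorems.PstarSharpGateBudgetAssembly (SharpMenuCriterionBoundGateBudget terminalFive_of_sharpMenuBoundGateBudget)
open Summit.PneNP.PneNP.Theorems.PstarMenuLocality (touches_pathSum_side)
open Summit.PneNP.PneNP.Theorems.PstarNearTruncation (nearMonomials mem_nearMonomials)
open Summit.PneNP.PneNP.Theorems.PstarLocalCriterion (far mem_far NoLocalCore noSmallPathSumSubcoreExact_of_noLocalCore)

namespace Summit.PneNP.PneNP.Theorems.PstarLocalGateBudgetAssembly

variable {n m : ℕ}

/-- **`LocalMenuCriterionBoundGateBudget` (OPEN, census-type, LOCAL (A) + semantic (B))**: on every terminal core with a centre that is covered,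
anchored, has no clean cut crossed twice, satisfies `GateBudget` and, when X-connected, has slack at least three and two dirty chords, there is
`ℬ ⊆ J₀` with `#ℬ + 2 ≤ #sharedSlots` such that every skeleton-connected outside-gated chord `c ∉ ℬ` satisfies, for each channel menu `G`,
`NoLocalCore c G` (no local core: truncated pair satisfiable, no `TerminalNC` sub-family of `K₀`) and `NoCoincidenceExact c G`.  FRONTIER. -/
@[conjecture] def LocalMenuCriterionBoundGateBudget : Prop :=
  ∀ (n m r : ℕ) (I : LocalMap 4 n m), I.IsPure xorAndPred → Typed I → SimpleOverlap I → BoundaryExpanding r I →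
    ∀ (y : Fin m → Bool) (J₀ : Finset (Fin m)) (w₁ w₂ : Finset (Fin n) × Finset (Fin m) × Bool), Terminal I r y J₀ w₁ w₂ →
      (∃ S ⊆ J₀, S.Nonempty ∧ (∀ w ∈ xverts I S, 2 ≤ xpdeg I S w) ∧ ∀ f ∈ S, ¬ IsChord I J₀ f) →
      Covered I J₀ (w₁.2.1 ∪ w₂.2.1) → Anchored I J₀ (w₁.2.1 ∪ w₂.2.1) → NoTwoCrossings I J₀ (w₁.2.1 ∪ w₂.2.1) →
      GateBudget I J₀ (w₁.2.1 ∪ w₂.2.1) →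
      (XConnected I J₀ → 3 * J₀.card + 3 ≤ 2 * (bdry I J₀).card ∧
        ∃ d₁ ∈ J₀, ∃ d₂ ∈ J₀, d₁ ≠ d₂ ∧ IsChord I J₀ d₁ ∧ ¬ OutsideGated I J₀ (w₁.2.1 ∪ w₂.2.1) d₁ ∧
          IsChord I J₀ d₂ ∧ ¬ OutsideGated I J₀ (w₁.2.1 ∪ w₂.2.1) d₂) →
      ∃ ℬ ⊆ J₀, ℬ.card + 2 ≤ (sharedSlots I J₀).card ∧
        ∀ c ∈ J₀, c ∉ ℬ → IsChord I J₀ c → OutsideGated I J₀ (w₁.2.1 ∪ w₂.2.1) c → SkConnected I J₀ (w₁.2.1 ∪ w₂.2.1) c →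
          ∀ G ∈ channelMenus I J₀ w₁ w₂, NoLocalCore I r y J₀ c G ∧ NoCoincidenceExact I J₀ c G

/-- **The local node implies the sharp gate-budget node** (local readers suffice for branch (A)). -/
theorem sharpGateBudget_of_local (h : LocalMenuCriterionBoundGateBudget) : SharpMenuCriterionBoundGateBudget := by
  intro n m r I hI hT hS hB y J₀ w₁ w₂ ht hS₀ hcov hanc hN2 hGB hx
  obtain ⟨ℬ, hℬJ, hℬ, hgood⟩ := h n m r I hI hT hS hB y J₀ w₁ w₂ ht hS₀ hcov hanc hN2 hGB hx
  refine ⟨ℬ, hℬJ, hℬ, fun c hc hcℬ hch hO hsk G hG => ?_⟩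
  obtain ⟨hA, hBc⟩ := hgood c hc hcℬ hch hO hsk G hG
  exact ⟨noSmallPathSumSubcoreExact_of_noLocalCore hI hT hS hB hA, hBc⟩

/-- **THE CORE BOUND FROM O2 AND THE LOCAL NODE.** -/
theorem terminalFive_of_localMenuBoundGateBudget (hO2 : TerminalFiveA) (hb : LocalMenuCriterionBoundGateBudget) : TerminalFive :=
  terminalFive_of_sharpMenuBoundGateBudget hO2 (sharpGateBudget_of_local hb)

/-- **O1 from the same inputs.** -/
theorem terminalPeelable_of_localMenuBoundGateBudget (hO2 : TerminalFiveA) (hb : LocalMenuCriterionBoundGateBudget) : TerminalPeelable :=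
  terminalPeelable_of_terminalFive (terminalFive_of_localMenuBoundGateBudget hO2 hb)

/-! ## Clustering of the certificates of one channel -/

variable {I : LocalMap 4 n m} {r : ℕ} {y : Fin m → Bool}

/-- **CLUSTERING.**  Two exact certificates of the same channel menu `G`: if the near variables of the second, `(K₀'; d₁', d₂')` with
`d₂'.2.1 = G ∪ F₂'`, all lie among the far variables of the first datum `(K₀, d₁)`, then every monomial of `G` has an AND variable far from `(K₀, d₁)`
(locality for the second certificate). -/
theorem menu_far_of_disjoint_near (hI : I.IsPure xorAndPred) (hT : Typed I) (hS : SimpleOverlap I) (hB : BoundaryExpanding r I)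
    {K₀ K₀' G F₂' : Finset (Fin m)} {d₁ d₁' d₂' : Finset (Fin n) × Finset (Fin m) × Bool} (ht' : Terminal I r y K₀' d₁' d₂')
    (hread' : ∀ u ∈ d₁'.1, ∃ f ∈ K₀', u ∈ varSet I f) (hm' : d₂'.2.1 = G ∪ F₂')
    (hdisj : ∀ v, v ∉ far I K₀' d₁' → v ∈ far I K₀ d₁) :
    ∀ g ∈ G, I.vars g 2 ∈ far I K₀ d₁ ∨ I.vars g 3 ∈ far I K₀ d₁ := by
  intro g hg
  have hg' : g ∈ d₂'.2.1 := by rw [hm']; exact mem_union_left _ hg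
  rcases touches_pathSum_side hI hT hS hB ht' hread' hg' with ⟨f, hf, h | h⟩ | ⟨f, hf, h⟩
  · exact Or.inl (hdisj _ fun hfar => ((mem_far I).1 hfar).1 f hf h)
  · exact Or.inr (hdisj _ fun hfar => ((mem_far I).1 hfar).1 f hf h)
  · rcases h with h | h | h | h
    · exact Or.inl (hdisj _ fun hfar => (((mem_far I).1 hfar).2.2 f hf).1 h)
    · exact Or.inl (hdisj _ fun hfar => (((mem_far I).1 hfar).2.2 f hf).2 h)
    · exact Or.inr (hdisj _ fun hfar => (((mem_far I).1 hfar).2.2 f hf).1 h)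
    · exact Or.inr (hdisj _ fun hfar => (((mem_far I).1 hfar).2.2 f hf).2 h)

/-- **… so the local reader of the first certificate is menu-free**: with every monomial of `G` far, `nearMonomials (G ∪ F₂) far = nearMonomials F₂ far`. -/
theorem nearMonomials_union_of_far (I : LocalMap 4 n m) {G F₂ : Finset (Fin m)} {Φ : Finset (Fin n)}
    (hG : ∀ g ∈ G, I.vars g 2 ∈ Φ ∨ I.vars g 3 ∈ Φ) : nearMonomials I (G ∪ F₂) Φ = nearMonomials I F₂ Φ := by
  ext g
  rw [mem_nearMonomials, mem_nearMonomials, mem_union]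
  constructor
  · rintro ⟨hg | hg, h2, h3⟩
    · exact absurd (hG g hg) (by push Not; exact ⟨h2, h3⟩)
    · exact ⟨hg, h2, h3⟩
  · rintro ⟨hg, h2, h3⟩
    exact ⟨Or.inr hg, h2, h3⟩

end Summit.PneNP.PneNP.Theorems.PstarLocalGateBudgetAssembly
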